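import Summits.FinalStateConjecture.FinalStateConjecture.Theorems.ClusterCompletenessOmegaLimitMultiKerrKerrAssembly
import Summits.FinalStateConjecture.FinalStateConjecture.Theorems.ClusterCompletenessOmegaLimitMultiKerrKerrExactChart
import Summits.FinalStateConjecture.FinalStateConjecture.Theorems.ClusterCompletenessOmegaLimitMultiKerrKerrHelix
import Summits.FinalStateConjecture.FinalStateConjecture.Theorems.ClusterCompletenessOmegaLimitMultiKerrKerrExhaustion
import Summits.FinalStateConjecture.FinalStateConjecture.Theorems.ClusterCompletenessOmegaLimitMultiKerrMinkowskiRecurs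
import Literature.Geometry.Lorentzian.KerrDataProofs
import Literature.Geometry.Lorentzian.KerrSchildCoord
import Literature.Geometry.Lorentzian.KerrSliceFacts
import HarnessLib

/-!
# Crux `ClusterCompleteness.OmegaLimitMultiKerr` (stmt-FinalStateConjecture-14664), line `Sketch` —
# the `N = 1` certificate: the exact sub-extremal Kerr slab development recurs at every order

Registered stub `recurs_kerrSlab_development` of the line lead (gen 2): composition of the four
landed Kerr stubs of this line,

* `kerrSlab_exactChart` (`…KerrExactChart.lean`) — the time-bent identity is an exactly isometric
  late chart of the Kerr slab development on the Kerr background (zero deviation after time `1`);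
* `kerrSlab_helix` (`…KerrHelix.lean`) — DRSR helices: late exterior points lie in `J⁺` of the data
  slice and every later chart time is reached, at the same radius, inside `I⁺`;
* `kerrSlab_exhaustion` (`…KerrExhaustion.lean`) — nothing escapes through `r = r₊` along future
  timelike curves, and `I⁻` of the late exterior lies below every later exterior slab;
* `recurs_kerrSlab_development_of` (`…KerrAssembly.lean`) — granted those three, an exhaustive
  one-hole `Cᵏ` final-state decomposition of the self-determined exterior exists for every `k`,
  hence `Recurs k` (`recurs_of_finalStateDecomposition`).

RESULT (`recurs_kerrSlab_development`): for `0 < M`, `|a| < M`, the vacuum Cauchy development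
`KerrSlab.development hM ha` of the exact Kerr data `Kerr.data M a M` (ingoing Kerr–Schild slab
`{t* ≥ 0} ∪ collar` over the slice `{t* = 0, r > M}`, horizon-penetrating) satisfies the recur
interface `Recurs k` of the crux — VERBATIM the hypothesis of the route target
`RecurrentMultiKerrCapture` — at EVERY order `k`, with ONE hole. Together with the `N = 0`
certificate `recurs_minkowski_vacuumCauchyDevelopment` this answers the route's cheap-vetting
clause (iv) for the recur-disjunct and the previous lead's `disprover-wanted`: the anchored
interface (boosted-Kerr hole charts on `boostedKerrExterior`, truncated slabs in `Kerr.radius`,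
the `1/4` anchor, separation, exhaustion with `Rᵢ → ∞`) is honestly satisfiable by black-hole
developments, so `X` is not secretly an `N = 0` statement and no clause of the hole side of the
interface is vacuous. `exists_blackHole_development_forall_recurs` is the instance-free corollary
(the standing hypotheses `[Kerr.Facts]`, `[Kerr.SliceFacts]` of the Kerr chart are theorems of the
tree).

References: Dafermos–Holzegel–Rodnianski–Taylor arXiv:2104.08222, §1; Dafermos–Rodnianski–
Shlapentokh-Rothman arXiv:1402.7034, Lemma 4.7.1 and §2.2.5; Dafermos–Luk arXiv:1710.01722, §1.2.1.
-/

-- every `Summit.FinalStateConjecture.FinalStateConjecture.…` name repeats the summit = sub-problem segment (D-0017 layout)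
set_option linter.dupNamespace false

noncomputable section

open scoped Manifold ContDiff Topology ENNReal
open Set Filter TopologicalSpace Function

namespace Summit.FinalStateConjecture.FinalStateConjecture.Theorems.ClusterCompleteness

open Literature.Geometry.Lorentzian
open Summit.FinalStateConjecture.FinalStateConjecture.Theorems.NearExtremalKappaCapture.UnitTemperatureFrontFace

/-- **The `N = 1` certificate** (registered stub `recurs_kerrSlab_development` of the crux's line
`Sketch`). The Kerr slab development of the exact sub-extremal Kerr data `Kerr.data M a M`
(`0 < M`, `|a| < M`) satisfies the recur interface `Recurs k` of the crux `OmegaLimitMultiKerr` —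
verbatim the hypothesis of the route target `RecurrentMultiKerrCapture` — at EVERY order `k`, with
one hole (the exact Kerr near zone, identity chart after time `1`) and the flat far chart outside
the `√t`-tube: composition of `kerrSlab_exactChart`, `kerrSlab_helix`, `kerrSlab_exhaustion` and
`recurs_kerrSlab_development_of`. DHRT arXiv:2104.08222, §1; Dafermos–Luk arXiv:1710.01722, §1.2.1.
[folklore] -/
theorem recurs_kerrSlab_development : ∀ [Kerr.Facts] [Kerr.SliceFacts] {M a : ℝ} (hM : 0 < M) (ha : |a| < M)
    (k : ℕ), Recurs k (KerrSlab.development hM ha) := by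
  intro _ _ M a hM ha k
  refine recurs_kerrSlab_development_of hM ha (kerrSlab_exactChart hM ha) (kerrSlab_helix hM ha)
    (fun hτ₀ _ hp ↦ ?_) k
  exact kerrSlab_exhaustion hM ha (kerrSlab_helix hM ha).2 hτ₀ hp

/-- **Instance-free form: a genuine black-hole development recurs at every order.** For all
`0 < M`, `|a| < M` there are a proof of the standing Kerr-chart hypotheses (the classes
`Kerr.Facts`, `Kerr.SliceFacts` are theorems of the tree: `Kerr.isConnected_region_holds`,
`Kerr.contMDiff_bilin_holds`, `Kerr.contMDiff_timeVector_holds`, `Kerr.sliceFacts_holds`) and a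
vacuum Cauchy development of the exact Kerr data `Kerr.data M a M` on the slice `{t* = 0, r > M}`
which satisfies `Recurs k` for every `k`. [folklore] -/
theorem exists_blackHole_development_forall_recurs {M a : ℝ} (hM : 0 < M) (ha : |a| < M) :
    ∃ (_ : Kerr.Facts) (_ : Kerr.SliceFacts) (𝒟 : VacuumCauchyDevelopment (Kerr.data M a M hM.le)),
      ∀ k : ℕ, Recurs k 𝒟 := by
  haveI hF : Kerr.Facts :=
    ⟨Kerr.isConnected_region_holds, Kerr.contMDiff_bilin_holds, Kerr.contMDiff_timeVector_holds⟩
  haveI hS : Kerr.SliceFacts := Kerr.sliceFacts_holds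
  exact ⟨hF, hS, KerrSlab.development hM ha, recurs_kerrSlab_development hM ha⟩

/-- **Both certificates side by side**: the recur interface of the crux (= the hypothesis of
`RecurrentMultiKerrCapture`) has, at every order `k`, a dispersive model WITHOUT holes (the
Minkowski development of the trivial datum, `recurs_minkowski_vacuumCauchyDevelopment`) AND a
black-hole model WITH a hole (the Kerr slab development, `recurs_kerrSlab_development`).
[folklore] -/
theorem recurs_models [Kerr.Facts] [Kerr.SliceFacts] {M a : ℝ} (hM : 0 < M) (ha : |a| < M)
    (k : ℕ) :
    Recurs k Minkowski.vacuumCauchyDevelopment ∧ Recurs k (KerrSlab.development hM ha) :=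
  ⟨recurs_minkowski_vacuumCauchyDevelopment k, recurs_kerrSlab_development hM ha k⟩

end Summit.FinalStateConjecture.FinalStateConjecture.Theorems.ClusterCompleteness

end
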